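import Summits.MatrixMultiplication.MatrixMultiplication.Theorems.OutsiderSandwichNoExactPerfection
import Summits.MatrixMultiplication.MatrixMultiplication.Theorems.OutsiderSandwichCwPowSliceReading

/-!
# OutsiderSandwich — no Kronecker power of `cw₂` PACKS exactly perfectly
(decomp-mm lens 4 «minimal-counterexample / extremal reduction», gen 37; kernel K37-1)

ω-free law, proved outright (route aside `CwTwoNoExactPerfectPacking`, item
stmt-MatrixMultiplication-32272): for every `N ≥ 1`, if `⟨F⟩ ⊗ ⟨m,m,m⟩` is a restriction of
`cw₂^{⊠N}` then `F·m² < 3^N` — the flattening bound `F·m² ≤ 3^N` of a PACKING of disjoint matrix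
products into a Kronecker power of the little Coppersmith–Winograd tensor is never attained.  The
case `F = 1` is `Theorems/OutsiderSandwichNoExactPerfection` (item 29786, gen 6); the packing version
says that the laser-method witnesses `⟨B⟩ ⊗ ⟨m,m,m⟩ ≤ cw₂^{⊠N}` behind `PerfectAtLaser` /
`LaserTangency` are genuinely asymptotic families (`B·m² = 3^{(1-o(1))N}`, never `= 3^N`).

Proof (the extremal packing is the minimal counterexample; it cannot exist).
1. `⟨F⟩ ⊗ ⟨m,m,m⟩` is concise, so the three restriction matrices have injective transposes
   (`toLin'_injective_of_restricts`), whence `F·m² ≤ 3^N` (`mul_sq_le_three_pow`).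
2. If `F·m² = 3^N` they are bijective.  Transport the covector `e_{0^N}`: the slice
   `cw₂^{⊠N}(0^N,·,·)` has rank `2^N` (`rank_sliceMat_cwPow_zero`), while every first-mode slice of
   `⟨F⟩ ⊗ ⟨m,m,m⟩` is block diagonal with rank `m · Σ_β rank ξ_β` (`rank_sliceMat_pack`); so
   `m ∣ 2^N`, and `m ∣ 3^N`, hence `m = 1` and `F = 3^N`: `cw₂^{⊠N} ≅ ⟨3^N⟩`.
3. `⟨3^N⟩` has a rank-one slice, so `cw₂^{⊠N}` would have a slice `T(η) = u vᵀ` with `η ≠ 0`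
   (`LB · E_{rr} · LCᵀ` is an outer product).  But at words that follow a letter-by-letter admissible
   pattern the slice reads off the coefficients of `η` (`cwPow_slice_entry`, kernel K37-1a
   `Theorems/OutsiderSandwichCwPowSliceReading`, theses-free), and in the first
   coordinate one finds a `2 × 2` minor equal to `η(a)² ≠ 0` — impossible for an outer product.
No rank theory is used in step 3 (only the vanishing of `2 × 2` minors of `u vᵀ`).
-/

set_option linter.dupNamespace false

namespace Summit.MatrixMultiplication.MatrixMultiplication.Theorems.OutsiderSandwichNoExactPerfectPacking

open Literature.Computability.AlgebraicComplexity
open OutsiderSandwichNoExactPerfection OutsiderSandwichCwPowSliceReading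
open scoped Matrix

/-! ## 1. Conciseness of the packing tensor `⟨F⟩ ⊗ ⟨m,m,m⟩` and the flattening bound -/

/-- The first-mode slices of `⟨F⟩ ⊗ ⟨m,m,m⟩` (`m ≥ 1`) are linearly independent. [folklore] -/
theorem linearIndependent_pack (F m : ℕ) [NeZero m] :
    LinearIndependent ℂ (fun a => kroneckerTensor (unitTensor ℂ F) (matMulTensor ℂ m m m) a :
      Fin F × (Fin m × Fin m) → Fin F × (Fin m × Fin m) → Fin F × (Fin m × Fin m) → ℂ) := by
  rw [Fintype.linearIndependent_iff]
  intro g hg v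
  obtain ⟨β, κ, ν⟩ := v
  have h := congr_fun (congr_fun hg (β, (κ, 0))) (β, (0, ν))
  rw [Finset.sum_apply, Finset.sum_apply, Fintype.sum_eq_single (β, (κ, ν))] at h
  · simpa [matMulTensor] using h
  · rintro ⟨β', κ', ν'⟩ hne
    simp only [Pi.smul_apply, kroneckerTensor_apply, unitTensor_apply, matMulTensor, smul_eq_mul,
      mul_ite, mul_one, mul_zero, ite_eq_right_iff]
    rintro ⟨h1, -, h3⟩ ⟨h4, -⟩
    exact absurd (Prod.ext h4 (Prod.ext h1 h3)) hne

/-- The second-mode slices of `⟨F⟩ ⊗ ⟨m,m,m⟩` (`m ≥ 1`) are linearly independent. [folklore] -/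
theorem linearIndependent_rotate_pack (F m : ℕ) [NeZero m] :
    LinearIndependent ℂ (fun b => rotate (kroneckerTensor (unitTensor ℂ F) (matMulTensor ℂ m m m)) b :
      Fin F × (Fin m × Fin m) → Fin F × (Fin m × Fin m) → Fin F × (Fin m × Fin m) → ℂ) := by
  rw [Fintype.linearIndependent_iff]
  intro g hg v
  obtain ⟨β, κ, μ⟩ := v
  have h := congr_fun (congr_fun hg (β, (μ, 0))) (β, (κ, 0))
  rw [Finset.sum_apply, Finset.sum_apply, Fintype.sum_eq_single (β, (κ, μ))] at h
  · simpa [matMulTensor] using h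
  · rintro ⟨β', κ', μ'⟩ hne
    simp only [Pi.smul_apply, rotate_apply, kroneckerTensor_apply, unitTensor_apply, matMulTensor,
      smul_eq_mul, mul_ite, mul_one, mul_zero, ite_eq_right_iff]
    rintro ⟨h1, h2, -⟩ ⟨h4, -⟩
    exact absurd (Prod.ext h4.symm (Prod.ext h1.symm h2)) hne

/-- The third-mode slices of `⟨F⟩ ⊗ ⟨m,m,m⟩` (`m ≥ 1`) are linearly independent. [folklore] -/
theorem linearIndependent_rotate_rotate_pack (F m : ℕ) [NeZero m] :
    LinearIndependent ℂ
      (fun c => rotate (rotate (kroneckerTensor (unitTensor ℂ F) (matMulTensor ℂ m m m))) c :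
      Fin F × (Fin m × Fin m) → Fin F × (Fin m × Fin m) → Fin F × (Fin m × Fin m) → ℂ) := by
  rw [Fintype.linearIndependent_iff]
  intro g hg v
  obtain ⟨β, μ, ν⟩ := v
  have h := congr_fun (congr_fun hg (β, (0, ν))) (β, (0, μ))
  rw [Finset.sum_apply, Finset.sum_apply, Fintype.sum_eq_single (β, (μ, ν))] at h
  · simpa [matMulTensor] using h
  · rintro ⟨β', μ', ν'⟩ hne
    simp only [Pi.smul_apply, rotate_apply, kroneckerTensor_apply, unitTensor_apply, matMulTensor,
      smul_eq_mul, mul_ite, mul_one, mul_zero, ite_eq_right_iff]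
    rintro ⟨-, h2, h3⟩ ⟨-, h5⟩
    exact absurd (Prod.ext h5.symm (Prod.ext h2.symm h3.symm)) hne

/-- Conciseness ⟹ the three restriction matrices of `⟨F⟩ ⊗ ⟨m,m,m⟩ ≤ cw₂^{⊠N}` have injective
transposes. [folklore] -/
theorem injective_three_pack {N F m : ℕ} [NeZero m]
    {A B C : Fin F × (Fin m × Fin m) → (Fin N → Fin 3) → ℂ}
    (hs : ∀ a' b' c', kroneckerTensor (unitTensor ℂ F) (matMulTensor ℂ m m m) a' b' c' =
      ∑ a, ∑ b, ∑ c, A a' a * B b' b * C c' c * kroneckerPow (cwTensor ℂ 2) N a b c) :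
    Function.Injective (Matrix.toLin' (Matrix.of A)ᵀ) ∧
      Function.Injective (Matrix.toLin' (Matrix.of B)ᵀ) ∧
      Function.Injective (Matrix.toLin' (Matrix.of C)ᵀ) :=
  ⟨toLin'_injective_of_restricts hs (linearIndependent_pack F m),
    toLin'_injective_of_restricts (restricts_rotate hs) (linearIndependent_rotate_pack F m),
    toLin'_injective_of_restricts (restricts_rotate (restricts_rotate hs))
      (linearIndependent_rotate_rotate_pack F m)⟩

/-- **Flattening bound for packings**: `⟨F⟩ ⊗ ⟨m,m,m⟩ ≤ cw₂^{⊠N} ⟹ F·m² ≤ 3^N`. [folklore] -/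
theorem mul_sq_le_three_pow {N F m : ℕ}
    (h : TensorRestrictsTo (kroneckerPow (cwTensor ℂ 2) N)
      (kroneckerTensor (unitTensor ℂ F) (matMulTensor ℂ m m m))) :
    F * m ^ 2 ≤ 3 ^ N := by
  rcases Nat.eq_zero_or_pos m with rfl | hm
  · simp
  haveI : NeZero m := ⟨hm.ne'⟩
  obtain ⟨A, B, C, hs⟩ := h
  have hA := (injective_three_pack hs).1
  have := LinearMap.finrank_le_finrank_of_injective hA
  simpa [Module.finrank_fintype_fun_eq_card, Fintype.card_prod, Fintype.card_fun, sq] using this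

/-! ## 2. The slices of the packing tensor are block diagonal -/

/-- `rank (⟨F⟩ ⊗ ⟨m,m,m⟩)(ξ,·,·) = m · Σ_β rank ξ_β`: the first-mode slice at `ξ` is, after
reindexing, block diagonal with blocks `ξ_β` (read as `m × m` matrices) indexed by `(β, μ)`.
[folklore] -/
theorem rank_sliceMat_pack (F m : ℕ) (ξ : Fin F × (Fin m × Fin m) → ℂ) :
    (sliceMat (kroneckerTensor (unitTensor ℂ F) (matMulTensor ℂ m m m)) ξ).rank =
      m * ∑ β : Fin F, (Matrix.of fun κ ν : Fin m => ξ (β, (κ, ν))).rank := by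
  classical
  -- the blocks, indexed by `(β, μ)`
  set M : Fin F × Fin m → Matrix (Fin m) (Fin m) ℂ :=
    fun p => Matrix.of fun κ ν : Fin m => ξ (p.1, (κ, ν)) with hM
  -- row reindexing `(β,(κ,μ)) ↔ (κ,(β,μ))`, column reindexing `(β,(μ,ν)) ↔ (ν,(β,μ))`
  let eRow : Fin m × (Fin F × Fin m) ≃ Fin F × (Fin m × Fin m) :=
    ⟨fun x => (x.2.1, (x.1, x.2.2)), fun r => (r.2.1, (r.1, r.2.2)), fun _ => rfl, fun _ => rfl⟩
  let eCol : Fin m × (Fin F × Fin m) ≃ Fin F × (Fin m × Fin m) :=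
    ⟨fun x => (x.2.1, (x.2.2, x.1)), fun c => (c.2.2, (c.1, c.2.1)), fun _ => rfl, fun _ => rfl⟩
  have key : sliceMat (kroneckerTensor (unitTensor ℂ F) (matMulTensor ℂ m m m)) ξ =
      Matrix.reindex eRow eCol (Matrix.blockDiagonal M) := by
    ext ⟨β, κ, μ⟩ ⟨β', μ', ν⟩
    simp only [sliceMat, Matrix.of_apply, Matrix.reindex_apply, Matrix.submatrix_apply,
      Matrix.blockDiagonal_apply, hM]
    change ∑ a, ξ a * kroneckerTensor (unitTensor ℂ F) (matMulTensor ℂ m m m) a (β, (κ, μ)) (β', (μ', ν))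
      = if ((β, μ) : Fin F × Fin m) = (β', μ') then ξ (β, (κ, ν)) else 0
    by_cases hb : ((β, μ) : Fin F × Fin m) = (β', μ')
    · obtain ⟨rfl, rfl⟩ := Prod.mk.inj hb
      rw [if_pos rfl, Fintype.sum_eq_single (β, (κ, ν))]
      · simp [matMulTensor]
      · rintro ⟨β₀, κ₀, ν₀⟩ hne
        simp only [kroneckerTensor_apply, unitTensor_apply, matMulTensor, mul_ite, mul_one, mul_zero,
          ite_eq_right_iff]
        rintro ⟨h1, -, h3⟩ ⟨h4, -⟩
        exact absurd (Prod.ext h4 (Prod.ext h1 h3)) hne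
    · rw [if_neg hb]
      refine Finset.sum_eq_zero fun a _ => ?_
      simp only [kroneckerTensor_apply, unitTensor_apply, matMulTensor, mul_ite, mul_one, mul_zero]
      split_ifs with h1 h2
      · exact absurd (Prod.ext h2.2 h1.2.1) hb
      all_goals rfl
  rw [key, Matrix.rank_reindex, Literature.Barriers.ValiantsHypothesis.rank_blockDiagonal,
    Fintype.sum_prod_type]
  simp only [hM, Finset.sum_const, Finset.card_univ, Fintype.card_fin, smul_eq_mul]
  rw [Finset.mul_sum]

/-! ## 3. Exact perfect packings do not exist -/

/-- Step 2 of the proof: an exact perfect packing `⟨F⟩ ⊗ ⟨m,m,m⟩ ≤ cw₂^{⊠N}`, `F·m² = 3^N`, has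
`m = 1` (`m ∣ 2^N` by slice ranks, `m ∣ 3^N` by counting). [new] -/
theorem eq_one_of_exact {N F m : ℕ}
    (h : TensorRestrictsTo (kroneckerPow (cwTensor ℂ 2) N)
      (kroneckerTensor (unitTensor ℂ F) (matMulTensor ℂ m m m)))
    (heq : F * m ^ 2 = 3 ^ N) : m = 1 := by
  classical
  have h3pos : 0 < 3 ^ N := by positivity
  have hm : m ≠ 0 := by
    rintro rfl
    simp at heq
    omega
  haveI : NeZero m := ⟨hm⟩
  obtain ⟨A, B, C, hs⟩ := h
  obtain ⟨hA, hB, hC⟩ := injective_three_pack hs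
  have hcard : Fintype.card (Fin F × (Fin m × Fin m)) = Fintype.card (Fin N → Fin 3) := by
    simp [Fintype.card_prod, ← heq, sq]
  have hfin : Module.finrank ℂ (Fin F × (Fin m × Fin m) → ℂ) =
      Module.finrank ℂ ((Fin N → Fin 3) → ℂ) := by
    simp [Module.finrank_fintype_fun_eq_card, hcard]
  -- a covector `ξ₀` transported onto the indicator of the word `0^N`
  set e₀ : (Fin N → Fin 3) → ℂ := fun a => if a = 0 then 1 else 0 with he₀
  obtain ⟨ξ₀, hξ₀⟩ := (LinearMap.injective_iff_surjective_of_finrank_eq_finrank hfin).1 hA e₀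
  have hξ₀' : ξ₀ ᵥ* Matrix.of A = e₀ := by
    rw [← Matrix.mulVec_transpose]; simpa [Matrix.toLin'_apply] using hξ₀
  obtain ⟨LB, hLB⟩ := exists_left_inverse (Matrix.of B) hB hcard
  obtain ⟨LC, hLC⟩ := exists_left_inverse (Matrix.of C) hC hcard
  have hS : sliceMat (kroneckerTensor (unitTensor ℂ F) (matMulTensor ℂ m m m)) ξ₀ =
      Matrix.of B * sliceMat (kroneckerPow (cwTensor ℂ 2) N) e₀ * (Matrix.of C)ᵀ := by
    rw [sliceMat_restricts hs ξ₀, hξ₀']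
  have hrank := congrArg Matrix.rank hS
  rw [rank_sandwich _ _ LB LC hLB hLC, he₀, rank_sliceMat_cwPow_zero, rank_sliceMat_pack] at hrank
  -- `m ∣ 2^N` and `m ∣ 3^N`
  have h2 : m ∣ 2 ^ N := ⟨_, hrank.symm⟩
  have h3 : m ∣ 3 ^ N := ⟨F * m, by rw [← heq]; ring⟩
  by_contra hm1
  obtain ⟨p, hp, hpm⟩ := Nat.exists_prime_and_dvd hm1
  have hp2 : p ∣ 2 := hp.dvd_of_dvd_pow (hpm.trans h2)
  have hp3 : p ∣ 3 := hp.dvd_of_dvd_pow (hpm.trans h3)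
  have : p ∣ 1 := by
    have := Nat.dvd_sub hp3 hp2
    simpa using this
  exact hp.one_lt.ne' (Nat.dvd_one.mp this)

/-- Entries of the packing tensor with `m = 1`: `⟨F⟩ ⊗ ⟨1,1,1⟩ ≅ ⟨F⟩`. [folklore] -/
theorem pack_one_apply (F : ℕ) (v x y : Fin F × (Fin 1 × Fin 1)) :
    kroneckerTensor (unitTensor ℂ F) (matMulTensor ℂ 1 1 1) v x y =
      if v.1 = x.1 ∧ x.1 = y.1 then 1 else 0 := by
  have h1 : v.2.1 = x.2.1 := Subsingleton.elim _ _
  have h2 : x.2.2 = y.2.1 := Subsingleton.elim _ _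
  have h3 : v.2.2 = y.2.2 := Subsingleton.elim _ _
  simp [kroneckerTensor_apply, unitTensor_apply, matMulTensor, h1, h2, h3]

/-- **No exact perfect packing**: `⟨F⟩ ⊗ ⟨m,m,m⟩ ≤ cw₂^{⊠N}` with `N ≥ 1` forces `F·m² ≠ 3^N`.
[new] -/
theorem mul_sq_ne_three_pow {N F m : ℕ} (hN : 1 ≤ N)
    (h : TensorRestrictsTo (kroneckerPow (cwTensor ℂ 2) N)
      (kroneckerTensor (unitTensor ℂ F) (matMulTensor ℂ m m m))) :
    F * m ^ 2 ≠ 3 ^ N := by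
  classical
  intro heq
  have hm := eq_one_of_exact h heq
  subst hm
  have hF : F = 3 ^ N := by simpa using heq
  have hFpos : 0 < F := by rw [hF]; positivity
  obtain ⟨A, B, C, hs⟩ := h
  obtain ⟨hA, hB, hC⟩ := injective_three_pack hs
  have hcard : Fintype.card (Fin F × (Fin 1 × Fin 1)) = Fintype.card (Fin N → Fin 3) := by
    simp [Fintype.card_prod, hF]
  obtain ⟨LB, hLB⟩ := exists_left_inverse (Matrix.of B) hB hcard
  obtain ⟨LC, hLC⟩ := exists_left_inverse (Matrix.of C) hC hcard
  -- the basis covector at `r₀ = (0, (0,0))`: its slice is the matrix unit `E_{r₀ r₀}`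
  set r₀ : Fin F × (Fin 1 × Fin 1) := (⟨0, hFpos⟩, (0, 0)) with hr₀
  have hx1 : ∀ x : Fin F × (Fin 1 × Fin 1), x.1 = r₀.1 ↔ x = r₀ := fun x =>
    ⟨fun hx => Prod.ext hx (Subsingleton.elim _ _), fun hx => by rw [hx]⟩
  set ξ : Fin F × (Fin 1 × Fin 1) → ℂ := fun v => if v = r₀ then 1 else 0 with hξ
  have hSentry : ∀ x y, sliceMat (kroneckerTensor (unitTensor ℂ F) (matMulTensor ℂ 1 1 1)) ξ x y =
      if x = r₀ then (if y = r₀ then 1 else 0) else 0 := by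
    intro x y
    simp only [sliceMat, Matrix.of_apply, hξ, pack_one_apply, ite_mul, one_mul, zero_mul,
      Finset.sum_ite_eq', Finset.mem_univ, if_true]
    by_cases hx : x = r₀
    · subst hx
      by_cases hy : y = r₀
      · subst hy; simp
      · have hy' : ¬ y.1 = r₀.1 := fun h => hy ((hx1 y).1 h)
        rw [if_pos rfl, if_neg hy, if_neg]
        rintro ⟨-, h⟩
        exact hy' h.symm
    · have hx' : ¬ x.1 = r₀.1 := fun h => hx ((hx1 x).1 h)
      rw [if_neg hx, if_neg]
      rintro ⟨h, -⟩
      exact hx' h.symm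
  -- the transported covector and its slice, an outer product
  set η : (Fin N → Fin 3) → ℂ := ξ ᵥ* Matrix.of A with hη
  have hS : sliceMat (kroneckerTensor (unitTensor ℂ F) (matMulTensor ℂ 1 1 1)) ξ =
      Matrix.of B * sliceMat (kroneckerPow (cwTensor ℂ 2) N) η * (Matrix.of C)ᵀ := by
    rw [sliceMat_restricts hs ξ]
  have hT : sliceMat (kroneckerPow (cwTensor ℂ 2) N) η =
      LB * sliceMat (kroneckerTensor (unitTensor ℂ F) (matMulTensor ℂ 1 1 1)) ξ * LCᵀ := by
    calc sliceMat (kroneckerPow (cwTensor ℂ 2) N) η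
        = (LB * Matrix.of B) * sliceMat (kroneckerPow (cwTensor ℂ 2) N) η * (LC * Matrix.of C)ᵀ := by
          rw [hLB, hLC]; simp
      _ = LB * (Matrix.of B * sliceMat (kroneckerPow (cwTensor ℂ 2) N) η * (Matrix.of C)ᵀ) * LCᵀ := by
          simp only [Matrix.transpose_mul, Matrix.mul_assoc]
      _ = LB * sliceMat (kroneckerTensor (unitTensor ℂ F) (matMulTensor ℂ 1 1 1)) ξ * LCᵀ := by
          rw [← hS]
  have huv : ∀ b c, sliceMat (kroneckerPow (cwTensor ℂ 2) N) η b c = LB b r₀ * LC c r₀ := by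
    intro b c
    rw [hT]
    simp only [Matrix.mul_apply, Matrix.transpose_apply, hSentry, mul_ite, mul_one, mul_zero,
      Finset.sum_ite_eq', Finset.mem_univ, if_true, ite_mul, zero_mul]
  -- `η ≠ 0`: its slice sandwiches to the matrix unit, which is non-zero at `(r₀, r₀)`
  have hη0 : η ≠ 0 := by
    intro h0
    have h1 := hSentry r₀ r₀
    rw [if_pos rfl, if_pos rfl, hS, h0, sliceMat_zero] at h1
    simp at h1
  have huv' : ∀ b c, (∑ a', η a' * kroneckerPow (cwTensor ℂ 2) N a' b c) = LB b r₀ * LC c r₀ :=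
    fun b c => by simpa only [sliceMat, Matrix.of_apply] using huv b c
  exact false_of_cwPow_slice_eq_outer hN hη0 huv'

/-- **Aside `CwTwoNoExactPerfectPacking` of route OutsiderSandwich, proved by name** (item
stmt-MatrixMultiplication-32272): `N ≥ 1` and `⟨B⟩ ⊗ ⟨m,m,m⟩ ≤ cw₂^{⊠N}` force `B·m² < 3^N`.
[new] -/
theorem cwTwoNoExactPerfectPacking_holds :
    Summit.MatrixMultiplication.MatrixMultiplication.Theses.OutsiderSandwich.CwTwoNoExactPerfectPacking :=
  fun _N _B _m hN h => lt_of_le_of_ne (mul_sq_le_three_pow h) (mul_sq_ne_three_pow hN h)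

/-! ## 4. The «exact» census hands are all NO -/

/-- `⟨3⟩ ⊗ ⟨3,3,3⟩ ⋬ cw₂^{⊠3}` (`27 = 3³` would be an exact perfect packing). [new] -/
theorem not_pack_three_three_le_cwPow_three :
    ¬ TensorRestrictsTo (kroneckerPow (cwTensor ℂ 2) 3)
      (kroneckerTensor (unitTensor ℂ 3) (matMulTensor ℂ 3 3 3)) :=
  fun h => absurd (cwTwoNoExactPerfectPacking_holds 3 3 3 (by norm_num) h) (by norm_num)

/-- `⟨9⟩ ⊗ ⟨3,3,3⟩ ⋬ cw₂^{⊠4}` (`81 = 3⁴`). [new] -/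
theorem not_pack_nine_three_le_cwPow_four :
    ¬ TensorRestrictsTo (kroneckerPow (cwTensor ℂ 2) 4)
      (kroneckerTensor (unitTensor ℂ 9) (matMulTensor ℂ 3 3 3)) :=
  fun h => absurd (cwTwoNoExactPerfectPacking_holds 4 9 3 (by norm_num) h) (by norm_num)

/-- `⟨9⟩ ⊗ ⟨9,9,9⟩ ⋬ cw₂^{⊠6}` (`729 = 3⁶`). [new] -/
theorem not_pack_nine_nine_le_cwPow_six :
    ¬ TensorRestrictsTo (kroneckerPow (cwTensor ℂ 2) 6)
      (kroneckerTensor (unitTensor ℂ 9) (matMulTensor ℂ 9 9 9)) :=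
  fun h => absurd (cwTwoNoExactPerfectPacking_holds 6 9 9 (by norm_num) h) (by norm_num)

/-- `⟨3^N⟩ ⋬ cw₂^{⊠N}` in the packing currency (`m = 1`): no Kronecker power of `cw₂` (`N ≥ 1`)
restricts onto the unit tensor of its own flattening size — `cw₂^{⊠N}` is not (isomorphic to) a
diagonal tensor. [new] -/
theorem not_unit_three_pow_le_cwPow {N : ℕ} (hN : 1 ≤ N) :
    ¬ TensorRestrictsTo (kroneckerPow (cwTensor ℂ 2) N)
      (kroneckerTensor (unitTensor ℂ (3 ^ N)) (matMulTensor ℂ 1 1 1)) :=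
  fun h => absurd (cwTwoNoExactPerfectPacking_holds N (3 ^ N) 1 hN h) (by simp)

end Summit.MatrixMultiplication.MatrixMultiplication.Theorems.OutsiderSandwichNoExactPerfectPacking
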